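import Summits.CriticalPhenomena.CardyFormulaZ2.Theorems.CardySelfDualSegmentSmirnovBasePoint
import Literature.Probability.RandomPlanarGeometry.SLESixCrossingNondegenerate
import Literature.Probability.RandomPlanarGeometry.ConformalRectangleProofs

/-!
# Negative lemmas for the crux `CardySelfDualSegment.UniformMarginality` (stmt-CriticalPhenomena-5472), III —
# at the Smirnov base point the crude crossing probabilities CONVERGE, for every conformal rectangle;
# so UM at `t₀ = 0` is exactly joint continuity at `(t, δ) = (0, 0⁺)`

Support file (refuter, cdisprove seat `refuter-cdisprove-stmt-CriticalPhenomena-5472-0`, cycle 1;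
everything proved, no `sorry`, nothing defined, no named fact) for the disproof programme of the
crux `UniformMarginality` (work file `Cruxes/UniformMarginality/Disproof.lean`, §4).

* `cornerCrossingProb_zero_tendsto` — for EVERY conformal rectangle `R` the crude `M_0`-crossing
  probability `cornerCrossingProb 0 R δ` converges as `δ → 0⁺` to some `L ∈ (0, 1)` (namely Cardy's
  `F(η(φ_ζ R))`): the tree's proof of the route support `SmirnovBasePoint`
  (`ShearedSandwich.hasCrossingLimit_shear`, Smirnov's theorem pushed through the shear `φ_ζ`),
  uniformizing data of `φ_ζ R` (`MarkedDomain.exists_isUniformizing_holds`) and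
  `cardyFunction_mem_Ioo`.
* `cornerCrossingProb_zero_eventually_mem` — hence tightness at `t = 0`: eventually
  `c ≤ cornerCrossingProb 0 R δ ≤ 1 − c` for some `c = c(R) > 0` (companion of part II,
  `EndpointTightness.lean`, for the bond endpoint `t = 1`).
* `jointLimit_at_zero_of_uniformMarginality` — **the kill criterion at the base point**: UM implies
  that for every `R` the crude crossing probabilities converge JOINTLY,
  `cornerCrossingProb t R δ → L(R)` as `(t, δ) → (0, 0⁺)`. So UM is refuted at `t₀ = 0` by any single
  conformal rectangle `R` with a sequence `(t_k, δ_k) → (0, 0⁺)` along which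
  `cornerCrossingProb t_k R δ_k` stays away from Cardy's value `F(η(φ_ζ R))` of the SHEARED rectangle —
  equivalently, UM at the Smirnov point is the perturbative stability of Smirnov's theorem under the
  corner deformation, uniformly in how slowly `t_k → 0` relative to `δ_k`.
-/

noncomputable section

namespace Summit.CriticalPhenomena.CardyFormulaZ2.Theorems.UniformMarginality.Negative

open Filter Topology MeasureTheory Set
open Literature.Probability.Percolation Literature.Probability.LatticeModels
  Literature.Probability.RandomPlanarGeometry Literature.Barriers.CriticalPhenomena
open Summit.CriticalPhenomena.CardyFormulaZ2.Cruxes.SmirnovBasePoint.ShearedSandwich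
  (hasCrossingLimit_shear tendsto_sqrt_two_mul sqrt_two_mul_div_sqrt_two')

/-- **At `t = 0` the crude crossing probabilities converge, for every conformal rectangle**, to a
limit in `(0, 1)` (Cardy's value of the sheared rectangle `φ_ζ R`). [cite: Smirnov2001, Thm. 1] -/
theorem cornerCrossingProb_zero_tendsto (R : ConformalRectangle) :
    ∃ L ∈ Ioo (0 : ℝ) 1, Tendsto (cornerCrossingProb 0 R) (𝓝[>] 0) (𝓝 L) := by
  set S : ConformalRectangle :=
    R.map (shearHomeomorph triZeta Literature.Probability.Percolation.triZeta_im_ne_zero)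
  obtain ⟨φ, x, hφ⟩ := MarkedDomain.exists_isUniformizing_holds S
  refine ⟨Literature.Probability.RandomPlanarGeometry.cardyFunction (crossRatio x),
    cardyFunction_mem_Ioo (ConformalRectangle.crossRatio_mem_Ioo_of_isUniformizing hφ), ?_⟩
  have h := (hasCrossingLimit_shear R φ x hφ).comp tendsto_sqrt_two_mul
  refine h.congr fun δ => ?_
  simp only [Function.comp_apply, sqrt_two_mul_div_sqrt_two']

/-- **Tightness at the Smirnov point `t = 0`**: for every conformal rectangle `R` there is `c > 0`
with `c ≤ cornerCrossingProb 0 R δ ≤ 1 − c` for all small `δ > 0`. [folklore] -/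
theorem cornerCrossingProb_zero_eventually_mem (R : ConformalRectangle) :
    ∃ c > 0, ∀ᶠ δ in 𝓝[>] (0 : ℝ),
      c ≤ cornerCrossingProb 0 R δ ∧ cornerCrossingProb 0 R δ ≤ 1 - c := by
  obtain ⟨L, hL, hlim⟩ := cornerCrossingProb_zero_tendsto R
  set c : ℝ := min L (1 - L) / 2 with hc
  have hcpos : 0 < c := by
    have : 0 < min L (1 - L) := lt_min hL.1 (by linarith [hL.2])
    rw [hc]; linarith
  refine ⟨c, hcpos, ?_⟩
  have hlo : ∀ᶠ δ in 𝓝[>] (0 : ℝ), c < cornerCrossingProb 0 R δ :=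
    (tendsto_order.1 hlim).1 c (by
      have := min_le_left L (1 - L); rw [hc]; linarith [hL.1])
  have hhi : ∀ᶠ δ in 𝓝[>] (0 : ℝ), cornerCrossingProb 0 R δ < 1 - c :=
    (tendsto_order.1 hlim).2 (1 - c) (by
      have := min_le_right L (1 - L); rw [hc]; linarith [hL.2])
  filter_upwards [hlo, hhi] with δ h1 h2
  exact ⟨h1.le, h2.le⟩

/-- **Kill criterion at the base point.** `UniformMarginality` implies JOINT convergence at
`(t, δ) = (0, 0⁺)`: for every conformal rectangle `R` there is `L ∈ (0,1)` (the limit of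
`cornerCrossingProb 0 R δ`) such that for every `ε > 0` there are `η > 0` and `δ₀ > 0` with
`|cornerCrossingProb t R δ − L| < ε` whenever `dist t 0 < η` and `0 < δ < δ₀`. [folklore] -/
theorem jointLimit_at_zero_of_uniformMarginality
    (h : Summit.CriticalPhenomena.CardyFormulaZ2.Theses.CardySelfDualSegment.UniformMarginality)
    (R : ConformalRectangle) :
    ∃ L ∈ Ioo (0 : ℝ) 1, Tendsto (cornerCrossingProb 0 R) (𝓝[>] 0) (𝓝 L) ∧
      ∀ ε > 0, ∃ η > 0, ∃ δ₀ > 0, ∀ t : unitInterval, dist t 0 < η →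
        ∀ δ : ℝ, 0 < δ → δ < δ₀ → |cornerCrossingProb t R δ - L| < ε := by
  obtain ⟨L, hL, hlim⟩ := cornerCrossingProb_zero_tendsto R
  refine ⟨L, hL, hlim, fun ε hε => ?_⟩
  -- UM at `t₀ = 0` with `ε/2`
  obtain ⟨η, hη, hUM⟩ := h 0 R (ε / 2) (by linarith)
  -- convergence at `t = 0` with `ε/2`
  have hev : ∀ᶠ δ in 𝓝[>] (0 : ℝ), dist (cornerCrossingProb 0 R δ) L < ε / 2 :=
    Metric.tendsto_nhds.1 hlim (ε / 2) (by linarith)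
  rw [eventually_nhdsWithin_iff, Metric.eventually_nhds_iff] at hev
  obtain ⟨δ₀, hδ₀, hball⟩ := hev
  refine ⟨η, hη, δ₀, hδ₀, fun t ht δ hδ hδδ₀ => ?_⟩
  have h1 : |cornerCrossingProb t R δ - cornerCrossingProb 0 R δ| < ε / 2 := hUM t ht δ hδ
  have h2 : dist (cornerCrossingProb 0 R δ) L < ε / 2 :=
    hball (by rw [Real.dist_eq, sub_zero, abs_of_pos hδ]; exact hδδ₀) hδ
  rw [Real.dist_eq] at h2
  calc |cornerCrossingProb t R δ - L|
      = |(cornerCrossingProb t R δ - cornerCrossingProb 0 R δ) + (cornerCrossingProb 0 R δ - L)| := by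
        ring_nf
    _ ≤ |cornerCrossingProb t R δ - cornerCrossingProb 0 R δ| + |cornerCrossingProb 0 R δ - L| :=
        abs_add_le _ _
    _ < ε := by linarith

end Summit.CriticalPhenomena.CardyFormulaZ2.Theorems.UniformMarginality.Negative

end
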